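import Summits.Langlands.Langlands.Statement
import Literature.NumberTheory.GaloisRepresentations.WeilDelignePure
import HarnessLib

/-!
# The purity door to local–global compatibility (solo seat `solo-Langlands-informed`)

New mathematics relative to the audited statement `Summit.Langlands` (not a reproduction): the
typed form of the observation that **Galois-side weight–monodromy purity at a finite place `v`
reduces the local–global compatibility clause `LocalGlobalCompatibleAt 𝓡 ι π ρ v`
(`WD_v(ρ)^{F-ss} ≅ rec_v(π_v)`) to its semisimple part** (`WD_v(ρ)^{ss} ≅ rec_v(π_v)^{ss}`, the
part that survives `ℓ`-adic limits), given only that `rec_v(π_v)` is a *generic* Weil–Deligne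
representation (true for every local component of a cuspidal `π`: such `π_v` are generic, and
`rec` of a generic irreducible representation is a generic Weil–Deligne representation,
A'Campo–Hevesi–Thorne–Whitmore, arXiv:2607.11763, §6).

Mechanism (all kernel-checked, no named facts): a pure complex Weil–Deligne representation is
generic (`WeilDeligneRep.IsPure.isGeneric`, Literature, after Taylor–Yoshida 2007 Lemma 1.4 (4)
and Allen 2016 §1.2), and two generic Frobenius-semisimple Weil–Deligne representations with the
same Weil-group action are isomorphic (`AHTW2026_prop_6_0_5_generic_conj_holds`, Literature).
Hence NO automorphic-side purity (Ramanujan) and NO separate control of the monodromy operator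
is needed at `v` once `WD_v(ρ)^{F-ss}` is known to be pure: the door "D4" of the seat's
sharpest-statement document is ONE open statement per place, not two.

Semisimple compatibility is taken in REPRESENTATIVE form: a Frobenius-semisimple representative
`W` of the class `rec_v(π_v)` whose Weil-group action coincides with that of the
Frobenius-semisimplification of `ι WD_v(ρ)` (any isomorphism of the semisimple parts can be
absorbed into the choice of representative, classes being isomorphism classes).

References: R. Taylor, T. Yoshida, *Compatibility of local and global Langlands
correspondences*, J. Amer. Math. Soc. 20 (2007), Lemma 1.4 [TaylorYoshida2007];
L. A'Campo, B. Hevesi, J. A. Thorne, D. Whitmore, arXiv:2607.11763 (2026), Prop. 6.0.5,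
Cor. 6.0.6 [AHTW2026]; P. Allen, Duke Math. J. 165 (2016), §1.2 [Allen2016].
-/

namespace Summit.Langlands.Langlands.Theorems

open scoped MatrixGroups Matrix Classical Polynomial NumberField
open NumberField IsDedekindDomain Field Polynomial Filter
open Literature.NumberTheory.Automorphic Literature.NumberTheory.GaloisRepresentations

section Local

variable {L : Type} [Field L] [ValuativeRel L] [TopologicalSpace L] [IsNonarchimedeanLocalField L]
  {n : ℕ}

/-- **Purity pins the Frobenius-semisimple class.** If the Frobenius-semisimplification `r'` of a
complex Weil–Deligne representation `r` on `ℂⁿ` is pure (of some weight `k`, with respect to a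
geometric Frobenius lift `φ`), then `r^{F-ss}` has the class of ANY generic Frobenius-semisimple
`W` with the same Weil-group action as `r'`. (Pure ⇒ generic, Taylor–Yoshida's argument; generic
orbit unique, AHTW Prop. 6.0.5.) [cite: TaylorYoshida2007, Lemma 1.4 (4)]
[cite: AHTW2026, Prop. 6.0.5] -/
theorem hasFrobSemisimpleClass_of_isPure {r r' : WeilDeligneRep L ℂ (Fin n → ℂ)}
    (h : r'.IsFrobSemisimplificationOf r) {φ : WeilGroup L} (hφ : WeilGroup.deg φ = -1) {k : ℝ}
    (hpure : r'.IsPure φ k)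
    (W : {W : WeilDeligneRep L ℂ (Fin n → ℂ) // W.IsFrobSemisimple}) (hρ : W.1.ρ = r'.ρ)
    (hgen : W.1.IsGeneric) :
    r.HasFrobSemisimpleClass (Quotient.mk (frobSemisimpleWDSetoid L n) W) :=
  ⟨r', h, Quotient.sound (hpure.isEquivalent_of_isGeneric hφ h.isFrobSemisimple hρ hgen)⟩

/-- Two-sided variant (Taylor–Yoshida Lemma 1.4 (4) verbatim: "given `(V, r)` with `r` semisimple
there is, up to equivalence, at most one `N` which makes `(V, r, N)` pure"): if `r'` (the
Frobenius-semisimplification of `r`) and `W` are both pure and have the same Weil-group action,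
then `r^{F-ss}` has the class of `W`. [cite: TaylorYoshida2007, Lemma 1.4 (4)] -/
theorem hasFrobSemisimpleClass_of_isPure_of_isPure {r r' : WeilDeligneRep L ℂ (Fin n → ℂ)}
    (h : r'.IsFrobSemisimplificationOf r) {φ : WeilGroup L} (hφ : WeilGroup.deg φ = -1) {k k' : ℝ}
    (hpure : r'.IsPure φ k)
    (W : {W : WeilDeligneRep L ℂ (Fin n → ℂ) // W.IsFrobSemisimple}) (hρ : W.1.ρ = r'.ρ)
    (hW : W.1.IsPure φ k') :
    r.HasFrobSemisimpleClass (Quotient.mk (frobSemisimpleWDSetoid L n) W) :=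
  ⟨r', h, Quotient.sound (hpure.isEquivalent hφ hW h.isFrobSemisimple hρ)⟩

end Local

variable {n : ℕ} {K : Type} [Field K] [NumberField K] {hcpt : isCompact_glFiniteIntegralLevel n K}
  {ℓ : ℕ} [Fact ℓ.Prime]

/-- **Door D4, typed against the summit statement: Galois-side purity at `v` ⇒ local–global
compatibility at `v`.**  Let `π_v` be the local component of `π` at `v`, `r = WD_v(ρ)` (by the
Grothendieck–Deligne recipe if `v ∤ ℓ`, through Fontaine's pinned `D_pst` datum if `v ∣ ℓ`),
`rℂ = ι(r)` its transport and `rss` a Frobenius-semisimplification of `rℂ`.  Assume SEMISIMPLE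
compatibility in representative form — a Frobenius-semisimple representative `W` of the class
`rec_v(π_v)` with `W.ρ = rss.ρ` — with `W` generic (automatic for local components of cuspidal
`π`), and assume that `rss` is PURE of some real weight `k` with respect to some geometric
Frobenius lift `φ`.  Then `LocalGlobalCompatibleAt 𝓡 ι π ρ v` holds: the monodromy operator and
the full Frobenius-semisimple type are forced.  No automorphic-side temperedness is used.
[cite: TaylorYoshida2007, Lemma 1.4 (4)] [cite: AHTW2026, Prop. 6.0.5 and Cor. 6.0.6] -/
theorem localGlobalCompatibleAt_of_isPure (𝓡 : ReciprocityData K) (ι : PadicAlgCl ℓ ≃+* ℂ)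
    (π : AutomorphicRepData (AutomorphyDatum.gl n K hcpt)) (ρ : FramedGaloisRep K (PadicAlgCl ℓ) n)
    (v : HeightOneSpectrum (𝓞 K))
    (πv : SmoothIrrep (GL (Fin n) (v.adicCompletion K))) (hπv : π.HasLocalComponentAt v πv.ρ)
    (r : WeilDeligneRep (v.adicCompletion K) (PadicAlgCl ℓ) (Fin n → PadicAlgCl ℓ))
    (hr : ((ℓ : ℕ) : 𝓞 K) ∉ v.asIdeal → IsWeilDeligneOfLadic (ρ.toLocal v).toWeilGroupHom r)
    (hr' : ∀ hv : ((ℓ : ℕ) : 𝓞 K) ∈ v.asIdeal, (𝓡.pst ℓ v hv).IsWeilDeligneOf (ρ.toLocal v) r)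
    (rℂ : WeilDeligneRep (v.adicCompletion K) ℂ (Fin n → ℂ))
    (hι : r.IsTransportAlong (ι : PadicAlgCl ℓ →+* ℂ) rℂ)
    (rss : WeilDeligneRep (v.adicCompletion K) ℂ (Fin n → ℂ))
    (hss : rss.IsFrobSemisimplificationOf rℂ)
    (W : {W : WeilDeligneRep (v.adicCompletion K) ℂ (Fin n → ℂ) // W.IsFrobSemisimple})
    (hW : Quotient.mk (frobSemisimpleWDSetoid (v.adicCompletion K) n) W =
      (𝓡.llc v).recGL n (IrrClass.mk πv))
    (hWρ : W.1.ρ = rss.ρ) (hgen : W.1.IsGeneric)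
    {φ : WeilGroup (v.adicCompletion K)} (hφ : WeilGroup.deg φ = -1) {k : ℝ} (hpure : rss.IsPure φ k) :
    LocalGlobalCompatibleAt 𝓡 ι π ρ v :=
  ⟨πv, r, rℂ, hπv, hr, hr', hι, hW ▸ hasFrobSemisimpleClass_of_isPure hss hφ hpure W hWρ hgen⟩

/-- The same door with TWO-SIDED purity (Taylor–Yoshida's original formulation: `rec_v(π_v)` pure,
e.g. `π_v` tempered, AND `WD_v(ρ)^{F-ss}` pure): again `LocalGlobalCompatibleAt 𝓡 ι π ρ v`
follows from semisimple compatibility. [cite: TaylorYoshida2007, Lemma 1.4 (3)–(4)] -/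
theorem localGlobalCompatibleAt_of_isPure_of_isPure (𝓡 : ReciprocityData K)
    (ι : PadicAlgCl ℓ ≃+* ℂ) (π : AutomorphicRepData (AutomorphyDatum.gl n K hcpt))
    (ρ : FramedGaloisRep K (PadicAlgCl ℓ) n) (v : HeightOneSpectrum (𝓞 K))
    (πv : SmoothIrrep (GL (Fin n) (v.adicCompletion K))) (hπv : π.HasLocalComponentAt v πv.ρ)
    (r : WeilDeligneRep (v.adicCompletion K) (PadicAlgCl ℓ) (Fin n → PadicAlgCl ℓ))
    (hr : ((ℓ : ℕ) : 𝓞 K) ∉ v.asIdeal → IsWeilDeligneOfLadic (ρ.toLocal v).toWeilGroupHom r)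
    (hr' : ∀ hv : ((ℓ : ℕ) : 𝓞 K) ∈ v.asIdeal, (𝓡.pst ℓ v hv).IsWeilDeligneOf (ρ.toLocal v) r)
    (rℂ : WeilDeligneRep (v.adicCompletion K) ℂ (Fin n → ℂ))
    (hι : r.IsTransportAlong (ι : PadicAlgCl ℓ →+* ℂ) rℂ)
    (rss : WeilDeligneRep (v.adicCompletion K) ℂ (Fin n → ℂ))
    (hss : rss.IsFrobSemisimplificationOf rℂ)
    (W : {W : WeilDeligneRep (v.adicCompletion K) ℂ (Fin n → ℂ) // W.IsFrobSemisimple})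
    (hW : Quotient.mk (frobSemisimpleWDSetoid (v.adicCompletion K) n) W =
      (𝓡.llc v).recGL n (IrrClass.mk πv))
    (hWρ : W.1.ρ = rss.ρ)
    {φ : WeilGroup (v.adicCompletion K)} (hφ : WeilGroup.deg φ = -1) {k k' : ℝ} (hpure : rss.IsPure φ k)
    (hWpure : W.1.IsPure φ k') :
    LocalGlobalCompatibleAt 𝓡 ι π ρ v :=
  ⟨πv, r, rℂ, hπv, hr, hr', hι,
    hW ▸ hasFrobSemisimpleClass_of_isPure_of_isPure hss hφ hpure W hWρ hWpure⟩

end Summit.Langlands.Langlands.Theorems
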